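import Summits.HubbardSuperconductivity.HubbardSuperconductivity.Theses.PlaquetteBoson
import Summits.HubbardSuperconductivity.HubbardSuperconductivity.Theorems.CooperPairDMottWalkBreathingAtOneIsPure
import Literature.MathematicalPhysics.QuantumLattice.PlaquetteBreathingSelfDuality

/-!
# Crux `PbContinuation` (stmt-HubbardSuperconductivity-0907) — ideation r1/k1 sketch

First lemmas of the crux idea card `all-doping-reductio` (planner-cruxidea-…-0907-1-0):
normal form of the crux as `∀ U δ, AnchorAt U δ → SummitAt U δ`, and the ALL-DOPING REDUCTIO:
the plaquette programme's own every-filling anchor at one `U₀` turns `PbContinuation` into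
"the PURE Hubbard torus at `U₀` is a `d_{x²-y²}` superconductor at EVERY doping `δ ∈ (0,1/2)`",
so ONE dark doping at `U₀` (e.g. the `d_xy` corner `n < 0.6`, Deng et al. 2015) refutes the crux.
All statements over existing declarations; pure logic.
-/

noncomputable section

set_option linter.dupNamespace false

namespace Summit.HubbardSuperconductivity.HubbardSuperconductivity.Cruxes.PbContinuation.IdeasR1K1

open Matrix
open Literature.MathematicalPhysics.QuantumLattice Literature.Probability.LatticeModels
open Summit.HubbardSuperconductivity.HubbardSuperconductivity.Theses.PlaquetteBoson

/-- The anchor premise of `PbContinuation` at `(U,δ)`: every-ground-state `d_{x²-y²}` order of the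
checkerboard torus `H_L(t',U)` for all small `t'`, eventually in `L ∈ 4ℕ` (verbatim sub-formula of
the crux). -/
def AnchorAt (U δ : ℝ) : Prop :=
  ∃ t₀ : ℝ, 0 < t₀ ∧ ∀ t' ∈ Set.Ioo (0:ℝ) t₀, ∃ c : ℝ, 0 < c ∧ ∃ L₀ : ℕ, ∀ (L : ℕ) [NeZero L],
    L₀ ≤ L → 4 ∣ L → ∀ (N : ℕ) (ψ : Fock (Orb (FermionTorus 2 L))),
      N = 2 * ⌊(1 - δ) * (L : ℝ) ^ 2 / 2⌋₊ → star ψ ⬝ᵥ ψ = 1 →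
      IsGroundStateInSector
        (hamiltonian ((fermionTorusGraph 2 L) \ SimpleGraph.comap
            (fun x : FermionTorus 2 L => fun i : Fin 2 => ((ofLex x) i : ℕ) / 2) ⊤) 1 U +
          hamiltonian ((fermionTorusGraph 2 L) ⊓ SimpleGraph.comap
            (fun x : FermionTorus 2 L => fun i : Fin 2 => ((ofLex x) i : ℕ) / 2) ⊤) t' 0) N 0 ψ →
      c * (L : ℝ) ^ 4 ≤ (expect ((pairField dWaveFormFactor L)ᴴ * pairField dWaveFormFactor L) ψ).re

/-- The summit's matrix at `(U,δ)` for the pure model (verbatim sub-formula of the crux). -/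
def SummitAt (U δ : ℝ) : Prop :=
  ∀ (N : ℕ → ℕ) (ψ : ∀ L, Fock (Orb (FermionTorus 2 L))),
    (∀ L, Even L → N L = 2 * ⌊(1 - δ) * (L : ℝ) ^ 2 / 2⌋₊ ∧ star (ψ L) ⬝ᵥ ψ L = 1 ∧
        IsGroundStateInSector (hubbardTorus 2 L 1 U) (N L) 0 (ψ L)) →
      HasLongRangeOrder (fun k => halfOpenBox 2 (2 * k))
        (fun k => torusPullback (pairFieldCorr dWaveFormFactor ψ) (2 * k))

/-- NORMAL FORM: the crux is the pointwise implication `AnchorAt → SummitAt` over all `(U,δ)`.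
[folklore] -/
theorem pbContinuation_iff :
    PbContinuation ↔ ∀ (U δ : ℝ), 0 < U → δ ∈ Set.Ioo (0:ℝ) (1/2) → AnchorAt U δ → SummitAt U δ :=
  Iff.rfl

/-- **ALL-DOPING REDUCTIO.** If the every-filling anchor holds at one coupling `U₀` (the intended
output of the bosonic engine `PbHalfFilledXYOrder + PbMonotoneDepletion + PbParticleHole +
PbInterpolation` dressed at every filling), then `PbContinuation` forces `d_{x²-y²}` pair-field LRO
of EVERY ground-state sequence of the PURE torus `hubbardTorus 2 L 1 U₀` at EVERY doping
`δ ∈ (0,1/2)`. [folklore] -/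
theorem allDoping_of_pbContinuation {U₀ : ℝ} (hU : 0 < U₀)
    (hA : ∀ δ ∈ Set.Ioo (0:ℝ) (1/2), AnchorAt U₀ δ) (hC : PbContinuation) :
    ∀ δ ∈ Set.Ioo (0:ℝ) (1/2), SummitAt U₀ δ :=
  fun δ hδ => hC U₀ δ hU hδ (hA δ hδ)

/-- **Refutation shape** (the skeleton of the negation line): one anchored-but-dark doping refutes
the crux. [folklore] -/
theorem not_pbContinuation_of_darkDoping {U₀ δ₁ : ℝ} (hU : 0 < U₀)
    (hδ₁ : δ₁ ∈ Set.Ioo (0:ℝ) (1/2)) (hA : AnchorAt U₀ δ₁) (hdark : ¬ SummitAt U₀ δ₁) :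
    ¬ PbContinuation :=
  fun hC => hdark (hC U₀ δ₁ hU hδ₁ hA)

/-- Conversely the crux holds VACUOUSLY wherever the anchor fails, and by the summit wherever the
summit holds: the crux is exactly `∀ (U,δ), ¬AnchorAt ∨ SummitAt`. [folklore] -/
theorem pbContinuation_iff_or :
    PbContinuation ↔ ∀ (U δ : ℝ), 0 < U → δ ∈ Set.Ioo (0:ℝ) (1/2) → (¬ AnchorAt U δ ∨ SummitAt U δ) := by
  rw [pbContinuation_iff]
  refine ⟨fun h U δ hU hδ => ?_, fun h U δ hU hδ hA => ?_⟩
  · by_cases hA : AnchorAt U δ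
    · exact Or.inr (h U δ hU hδ hA)
    · exact Or.inl hA
  · rcases h U δ hU hδ with hn | hs
    · exact (hn hA).elim
    · exact hs

/-! ## First lemma of card `two-tiling-ray`: the exact two-tiling sum identity

`H_A(1,t',U) + T_{(1,1)} H_A(1,t',U) T_{(1,1)}⁻¹ = hamiltonian G (1+t') (2U) = (1+t') • hubbardTorus 2 L 1 (2U/(1+t'))`:
the uniform Hubbard torus at coupling `2U/(1+t')` is (up to scale) the SUM of the two checkerboard
copies at `(t',U)`; along `t' ∈ (0,1]` the partner coupling runs over the RAY `[U, 2U]`. -/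

section TwoTiling

variable {L : ℕ} [NeZero L]

/-- Joint linearity of the Hubbard Hamiltonian in `(t,U)` on a fixed graph. [folklore] -/
theorem hamiltonian_add_hamiltonian_same {Λ : Type*} [LinearOrder Λ] [Fintype Λ]
    (X : SimpleGraph Λ) [DecidableRel X.Adj] (a b U V : ℝ) :
    hamiltonian X a U + hamiltonian X b V = hamiltonian X (a + b) (U + V) := by
  unfold hamiltonian
  push_cast
  rw [neg_add, add_smul]
  try rw [add_smul]
  abel

/-- Scaling: `hamiltonian X (c t) (c U) = c • hamiltonian X t U`. [folklore] -/
theorem hamiltonian_scale {Λ : Type*} [LinearOrder Λ] [Fintype Λ]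
    (X : SimpleGraph Λ) [DecidableRel X.Adj] (c t U : ℝ) :
    hamiltonian X (c * t) (c * U) = (c : ℂ) • hamiltonian X t U := by
  unfold hamiltonian
  push_cast
  rw [smul_add, smul_smul, smul_smul, mul_neg]

/-- **TWO-TILING SUM IDENTITY** (even `L ≥ 4`): the checkerboard Hamiltonian at `(1, t', U)` plus
its diagonal translate (= the complementary tiling, `relabel_translate_breathing`) is the UNIFORM
Hubbard Hamiltonian with hopping `1 + t'` and interaction `2U`. [folklore] -/
theorem twoTiling_sum (hL : Even L) (h4 : 4 ≤ L) (t' U : ℝ) :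
    (hamiltonian (fermionTorusGraph 2 L \ (⊤ : SimpleGraph (Fin 2 → ℕ)).comap
          (fun (x : FermionTorus 2 L) (i : Fin 2) => (ofLex x i : ℕ) / 2)) 1 U +
        hamiltonian (fermionTorusGraph 2 L ⊓ (⊤ : SimpleGraph (Fin 2 → ℕ)).comap
          (fun (x : FermionTorus 2 L) (i : Fin 2) => (ofLex x i : ℕ) / 2)) t' 0) +
      relabel (Orb.translate (fun _ : Fin 2 => (1 : ZMod L)))
        (hamiltonian (fermionTorusGraph 2 L \ (⊤ : SimpleGraph (Fin 2 → ℕ)).comap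
            (fun (x : FermionTorus 2 L) (i : Fin 2) => (ofLex x i : ℕ) / 2)) 1 U +
          hamiltonian (fermionTorusGraph 2 L ⊓ (⊤ : SimpleGraph (Fin 2 → ℕ)).comap
            (fun (x : FermionTorus 2 L) (i : Fin 2) => (ofLex x i : ℕ) / 2)) t' 0) =
      hamiltonian (fermionTorusGraph 2 L) (1 + t') (2 * U) := by
  rw [relabel_translate_breathing hL h4 1 t' U]
  have key : ∀ (A B C D : Matrix (Finset (Orb (FermionTorus 2 L))) (Finset (Orb (FermionTorus 2 L))) ℂ),
      (A + B) + (C + D) = (A + C) + (B + D) := fun A B C D => by abel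
  rw [key, hamiltonian_add_hamiltonian_same, hamiltonian_add_hamiltonian_same,
    show U + U = 2 * U by ring, show t' + (1 : ℝ) = 1 + t' by ring,
    show (0 : ℝ) + 0 = 0 by ring]
  exact Summit.HubbardSuperconductivity.HubbardSuperconductivity.Theorems.CooperPairDMottWalk.hamiltonian_sdiff_add_inf
    _ _ (1 + t') (2 * U)

/-- The partner coupling on the ray: for `0 ≤ t'`,
`hamiltonian G (1+t') (2U) = (1+t') • hubbardTorus 2 L 1 (2U/(1+t'))`. [folklore] -/
theorem twoTiling_partner (t' U : ℝ) (ht : 0 ≤ t') :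
    hamiltonian (fermionTorusGraph 2 L) (1 + t') (2 * U) =
      ((1 + t' : ℝ) : ℂ) • hubbardTorus 2 L 1 (2 * U / (1 + t')) := by
  have h : (1 + t') ≠ 0 := by positivity
  rw [hubbardTorus, ← hamiltonian_scale]
  congr 1 <;> field_simp

end TwoTiling

end Summit.HubbardSuperconductivity.HubbardSuperconductivity.Cruxes.PbContinuation.IdeasR1K1

end
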